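import Summits.BirchSwinnertonDyer.Rank1Residual.GaloisImage.CongruenceVisibilityIdentityComponentIndexEnds
import Summits.BirchSwinnertonDyer.Rank1Residual.GaloisImage.CongruenceVisibilityIdentityComponentRat
import HarnessLib

/-!
# THEOREM B through the master count, over `ℚ` at `v₀ = 3` (cell `b2b-bsdres`, team n1011, seat
# p10 GEN 9; ROW T-VIS3-UC-IOTA FILE 3; skeleton `cells/n1011/skel/T-VIS3-UC-IOTA.md`)

HONEST FRAMING (cell `b2b-bsdres`, run/shared/lean/b2b/bsd-rank1-residual/, verbatim in every
file): the goal of the cell is to DELETE the COMBINATION-SHAPED residual classes of the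
Birch–Swinnerton-Dyer formula for ALL analytic-rank `≤ 1` elliptic curves over `ℚ` — "full BSD
formula for every rank `≤ 1` curve in class `C`" assembled STRICTLY from published theorems — so
that the rank-`≤ 1` remainder becomes exactly the CONSTRUCTION-SHAPED classes, which are TYPED
(missing-input `Prop`s), NOT attempted. This is not "finishing BSD". Team n1011 (N10 / N11):
research route on the CONSTRUCTION-SHAPED class X4 (§I N11 LOWER half / O7); no claim beyond the
stated classes; nothing is booked; marks UNCHANGED. Theorems only: no definition, no named fact,
no `sorry`. RECORD-SHAPE theorems; they close nothing by themselves.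

## What

The `ℚ` wrappers of FILE 2's receiver shapes at `primesEquiv v₀ = 3`: the side inputs `3 ∈ v₀`,
`#(ℤ₃/3) = 3` and the three `ℚ₃`-facts (`−23` square, `−3` non-square, `X³ − X − 1` rootless) are
discharged as in FILE 8d (`CongruenceVisibilityIdentityComponentRat`):
`exists_sha_ne_zero_of_congr_of_identityComponent_of_rank_two_rat` (rank-`0` receivers, `2 ≤ rank E'`),
`…_of_index_le_three_rat` (rank-`1` receivers, `3 ≤ rank E'`), `…_of_prod_lt_rat` (general budget).
A record then displays `θ hθ`, `S hS`, the Mordell–Weil inputs (`hfin hcop` / `hidxE`, `hrank`),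
`hoff` or the comparison indices at the bad places `v ≠ 3`, `hcard hcard'` (T-LOC3L), and per curve
`(M C hC x₀ y₀ a hcusp) (a₀ b₀ hns₀ hm h3)` (T-SIG3-TRI); rank-`0` X4 rows close `BSDp W 3` by n1011-p14's
`X4RankZero.bsdp_three_potMult_of_exists_sha_three_torsion` / `…bsdp_of_exists_sha_torsion_of_kato`.
References: [CremonaMazur2000] §3 and Table 1; [AgasheStein2002] Thm. 3.1, §3.5; [MilneADT2006]
I.3.3, I.3.8; L41-NOTE §§1–2 (`HOME/b2b-bsdres-n1011-p10/g8/`). -/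

noncomputable section

open scoped Classical

namespace Summit.BirchSwinnertonDyer.Rank1Residual.GaloisImage.TwistedWitness

open WeierstrassCurve Literature.NumberTheory.EllipticCurves Literature.NumberTheory.GaloisRepresentations
open Field NumberField IsDedekindDomain IsDedekindDomain.HeightOneSpectrum Rat.HeightOneSpectrum

/-- **The general budget over `ℚ` at `3`** (`…_of_prod_lt` with the side inputs at `3` discharged):
`[E(ℚ):3E(ℚ)] · 3 · ∏_{v ∈ S ∖ v₀} ι_v(θ) < [E'(ℚ):3E'(ℚ)]`, the indices stated with `ℚ`'s decidable
equality and converted to the tree's classical group law (`Subsingleton (DecidableEq ℚ)`).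
[cite: CremonaMazur2000, §3 and Table 1] [cite: AgasheStein2002, Thm. 3.1 and §3.5]
[cite: MilneADT2006, Ch. I Prop. 3.8 and Lemma 3.3] -/
theorem exists_sha_ne_zero_of_congr_of_identityComponent_of_prod_lt_rat (W W' : WeierstrassCurve ℚ)
    [W.IsElliptic] [W'.IsElliptic]
    (θ : geomTorsion W' ((3 : ℕ) : ℤ) ≃+ geomTorsion W ((3 : ℕ) : ℤ))
    (hθ : ∀ (σ : absoluteGaloisGroup ℚ) (P : geomTorsion W' ((3 : ℕ) : ℤ)), θ (σ • P) = σ • θ P)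
    (S : Finset (HeightOneSpectrum (𝓞 ℚ)))
    (hS : ∀ v : HeightOneSpectrum (𝓞 ℚ), v ∉ S →
      W.HasGoodReductionAt v ∧ W'.HasGoodReductionAt v ∧ ((3 : ℕ) : 𝓞 ℚ) ∉ v.asIdeal)
    (v₀ : HeightOneSpectrum (𝓞 ℚ)) (hv₀ : (primesEquiv v₀ : ℕ) = 3)
    (hbud : (zsmulAddGroupHom ((3 : ℕ) : ℤ) : W.toAffine.Point →+ W.toAffine.Point).range.index *
      (3 * ∏ v ∈ S.erase v₀, (selmerLocalKer W (v.adicCompletion ℚ) ((3 : ℕ) : ℤ)).relIndex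
        ((selmerLocalKer W' (v.adicCompletion ℚ) ((3 : ℕ) : ℤ)).map (h1Equiv θ hθ).toAddMonoidHom)) <
      (zsmulAddGroupHom ((3 : ℕ) : ℤ) : W'.toAffine.Point →+ W'.toAffine.Point).range.index)
    (hcard : Nat.card (nsmulAddMonoidHom 3 :
      (W.baseChange (v₀.adicCompletion ℚ)).toAffine.Point →+ _).ker = 3)
    (hcard' : Nat.card (nsmulAddMonoidHom 3 :
      (W'.baseChange (v₀.adicCompletion ℚ)).toAffine.Point →+ _).ker = 3)
    (M : WeierstrassCurve (v₀.adicCompletionIntegers ℚ)) (C : VariableChange (v₀.adicCompletion ℚ))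
    (hC : C • W.baseChange (v₀.adicCompletion ℚ) =
      M.map (algebraMap (v₀.adicCompletionIntegers ℚ) (v₀.adicCompletion ℚ)))
    (x₀ y₀ a : IsLocalRing.ResidueField (v₀.adicCompletionIntegers ℚ))
    (hcusp : M.map (IsLocalRing.residue (v₀.adicCompletionIntegers ℚ)) = singularModel x₀ y₀ a a)
    {a₀ b₀ : v₀.adicCompletionIntegers ℚ}
    (hns₀ : (M.map (IsLocalRing.residue (v₀.adicCompletionIntegers ℚ))).toAffine.Nonsingular
      (IsLocalRing.residue (v₀.adicCompletionIntegers ℚ) a₀)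
      (IsLocalRing.residue (v₀.adicCompletionIntegers ℚ) b₀))
    (hm : ((M.map (algebraMap (v₀.adicCompletionIntegers ℚ) (v₀.adicCompletion ℚ))).baseChange
        (AlgebraicClosure (v₀.adicCompletion ℚ))).toAffine.Nonsingular
      (algebraMap (v₀.adicCompletionIntegers ℚ) (AlgebraicClosure (v₀.adicCompletion ℚ)) a₀)
      (algebraMap (v₀.adicCompletionIntegers ℚ) (AlgebraicClosure (v₀.adicCompletion ℚ)) b₀))
    (h3 : (3 : ℤ) • (Affine.Point.some _ _ hm :
      ((M.map (algebraMap (v₀.adicCompletionIntegers ℚ) (v₀.adicCompletion ℚ))).baseChange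
        (AlgebraicClosure (v₀.adicCompletion ℚ))).toAffine.Point) = 0)
    (M' : WeierstrassCurve (v₀.adicCompletionIntegers ℚ)) (C' : VariableChange (v₀.adicCompletion ℚ))
    (hC' : C' • W'.baseChange (v₀.adicCompletion ℚ) =
      M'.map (algebraMap (v₀.adicCompletionIntegers ℚ) (v₀.adicCompletion ℚ)))
    (x₀' y₀' a' : IsLocalRing.ResidueField (v₀.adicCompletionIntegers ℚ))
    (hcusp' : M'.map (IsLocalRing.residue (v₀.adicCompletionIntegers ℚ)) = singularModel x₀' y₀' a' a')
    {a₀' b₀' : v₀.adicCompletionIntegers ℚ}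
    (hns₀' : (M'.map (IsLocalRing.residue (v₀.adicCompletionIntegers ℚ))).toAffine.Nonsingular
      (IsLocalRing.residue (v₀.adicCompletionIntegers ℚ) a₀')
      (IsLocalRing.residue (v₀.adicCompletionIntegers ℚ) b₀'))
    (hm' : ((M'.map (algebraMap (v₀.adicCompletionIntegers ℚ) (v₀.adicCompletion ℚ))).baseChange
        (AlgebraicClosure (v₀.adicCompletion ℚ))).toAffine.Nonsingular
      (algebraMap (v₀.adicCompletionIntegers ℚ) (AlgebraicClosure (v₀.adicCompletion ℚ)) a₀')
      (algebraMap (v₀.adicCompletionIntegers ℚ) (AlgebraicClosure (v₀.adicCompletion ℚ)) b₀'))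
    (h3' : (3 : ℤ) • (Affine.Point.some _ _ hm' :
      ((M'.map (algebraMap (v₀.adicCompletionIntegers ℚ) (v₀.adicCompletion ℚ))).baseChange
        (AlgebraicClosure (v₀.adicCompletion ℚ))).toAffine.Point) = 0) :
    ∃ c : W.sha, c ≠ 0 ∧ 3 • c = 0 := by
  obtain ⟨⟨δ, hδ⟩, hn3, hnoroot⟩ := three_facts_adicCompletion_three hv₀
  exact exists_sha_ne_zero_of_congr_of_identityComponent_of_prod_lt W W' θ hθ S hS v₀
    (Literature.NumberTheory.EllipticCurves.Rank1Residual.natCast_mem_asIdeal_of_primesEquiv_eq hv₀)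
    (by convert hbud) (natCard_quot_three_of_primesEquiv_eq hv₀) hδ hnoroot hn3 hcard hcard'
    M C hC x₀ y₀ a hcusp hns₀ hm h3 M' C' hC' x₀' y₀' a' hcusp' hns₀' hm' h3'

/-- **The rank-`0` receiver shape over `ℚ` at `3`** (`…_of_rank_two` with `3 ∈ v₀`, `#(ℤ₃/3) = 3`
and the three `ℚ₃`-facts discharged, as in FILE 8d). Per row a record displays `θ hθ`, `S hS`,
`hfin hcop` (or derives them from `analyticRank = 0` + irreducibility), `hrank`, `hoff` at the bad
places `v ≠ 3`, `hcard hcard'` (T-LOC3L), and per curve `(M C hC x₀ y₀ a hcusp) (a₀ b₀ hns₀ hm h3)`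
(T-SIG3-TRI). [cite: CremonaMazur2000, §3 and Table 1] [cite: AgasheStein2002, Thm. 3.1]
[cite: MilneADT2006, Ch. I Prop. 3.8 and Lemma 3.3] -/
theorem exists_sha_ne_zero_of_congr_of_identityComponent_of_rank_two_rat (W W' : WeierstrassCurve ℚ)
    [W.IsElliptic] [W'.IsElliptic]
    (θ : geomTorsion W' ((3 : ℕ) : ℤ) ≃+ geomTorsion W ((3 : ℕ) : ℤ))
    (hθ : ∀ (σ : absoluteGaloisGroup ℚ) (P : geomTorsion W' ((3 : ℕ) : ℤ)), θ (σ • P) = σ • θ P)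
    (S : Finset (HeightOneSpectrum (𝓞 ℚ)))
    (hS : ∀ v : HeightOneSpectrum (𝓞 ℚ), v ∉ S →
      W.HasGoodReductionAt v ∧ W'.HasGoodReductionAt v ∧ ((3 : ℕ) : 𝓞 ℚ) ∉ v.asIdeal)
    (hfin : Finite W.toAffine.Point) (hcop : (Nat.card W.toAffine.Point).Coprime 3)
    (hrank : 2 ≤ W'.mordellWeilRank)
    (v₀ : HeightOneSpectrum (𝓞 ℚ)) (hv₀ : (primesEquiv v₀ : ℕ) = 3)
    (hoff : ∀ v ∈ S, v ≠ v₀ →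
      (selmerLocalKer W (v.adicCompletion ℚ) ((3 : ℕ) : ℤ)).relIndex
        ((selmerLocalKer W' (v.adicCompletion ℚ) ((3 : ℕ) : ℤ)).map (h1Equiv θ hθ).toAddMonoidHom) = 1)
    (hcard : Nat.card (nsmulAddMonoidHom 3 :
      (W.baseChange (v₀.adicCompletion ℚ)).toAffine.Point →+ _).ker = 3)
    (hcard' : Nat.card (nsmulAddMonoidHom 3 :
      (W'.baseChange (v₀.adicCompletion ℚ)).toAffine.Point →+ _).ker = 3)
    (M : WeierstrassCurve (v₀.adicCompletionIntegers ℚ)) (C : VariableChange (v₀.adicCompletion ℚ))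
    (hC : C • W.baseChange (v₀.adicCompletion ℚ) =
      M.map (algebraMap (v₀.adicCompletionIntegers ℚ) (v₀.adicCompletion ℚ)))
    (x₀ y₀ a : IsLocalRing.ResidueField (v₀.adicCompletionIntegers ℚ))
    (hcusp : M.map (IsLocalRing.residue (v₀.adicCompletionIntegers ℚ)) = singularModel x₀ y₀ a a)
    {a₀ b₀ : v₀.adicCompletionIntegers ℚ}
    (hns₀ : (M.map (IsLocalRing.residue (v₀.adicCompletionIntegers ℚ))).toAffine.Nonsingular
      (IsLocalRing.residue (v₀.adicCompletionIntegers ℚ) a₀)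
      (IsLocalRing.residue (v₀.adicCompletionIntegers ℚ) b₀))
    (hm : ((M.map (algebraMap (v₀.adicCompletionIntegers ℚ) (v₀.adicCompletion ℚ))).baseChange
        (AlgebraicClosure (v₀.adicCompletion ℚ))).toAffine.Nonsingular
      (algebraMap (v₀.adicCompletionIntegers ℚ) (AlgebraicClosure (v₀.adicCompletion ℚ)) a₀)
      (algebraMap (v₀.adicCompletionIntegers ℚ) (AlgebraicClosure (v₀.adicCompletion ℚ)) b₀))
    (h3 : (3 : ℤ) • (Affine.Point.some _ _ hm :
      ((M.map (algebraMap (v₀.adicCompletionIntegers ℚ) (v₀.adicCompletion ℚ))).baseChange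
        (AlgebraicClosure (v₀.adicCompletion ℚ))).toAffine.Point) = 0)
    (M' : WeierstrassCurve (v₀.adicCompletionIntegers ℚ)) (C' : VariableChange (v₀.adicCompletion ℚ))
    (hC' : C' • W'.baseChange (v₀.adicCompletion ℚ) =
      M'.map (algebraMap (v₀.adicCompletionIntegers ℚ) (v₀.adicCompletion ℚ)))
    (x₀' y₀' a' : IsLocalRing.ResidueField (v₀.adicCompletionIntegers ℚ))
    (hcusp' : M'.map (IsLocalRing.residue (v₀.adicCompletionIntegers ℚ)) = singularModel x₀' y₀' a' a')
    {a₀' b₀' : v₀.adicCompletionIntegers ℚ}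
    (hns₀' : (M'.map (IsLocalRing.residue (v₀.adicCompletionIntegers ℚ))).toAffine.Nonsingular
      (IsLocalRing.residue (v₀.adicCompletionIntegers ℚ) a₀')
      (IsLocalRing.residue (v₀.adicCompletionIntegers ℚ) b₀'))
    (hm' : ((M'.map (algebraMap (v₀.adicCompletionIntegers ℚ) (v₀.adicCompletion ℚ))).baseChange
        (AlgebraicClosure (v₀.adicCompletion ℚ))).toAffine.Nonsingular
      (algebraMap (v₀.adicCompletionIntegers ℚ) (AlgebraicClosure (v₀.adicCompletion ℚ)) a₀')
      (algebraMap (v₀.adicCompletionIntegers ℚ) (AlgebraicClosure (v₀.adicCompletion ℚ)) b₀'))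
    (h3' : (3 : ℤ) • (Affine.Point.some _ _ hm' :
      ((M'.map (algebraMap (v₀.adicCompletionIntegers ℚ) (v₀.adicCompletion ℚ))).baseChange
        (AlgebraicClosure (v₀.adicCompletion ℚ))).toAffine.Point) = 0) :
    ∃ c : W.sha, c ≠ 0 ∧ 3 • c = 0 := by
  obtain ⟨⟨δ, hδ⟩, hn3, hnoroot⟩ := three_facts_adicCompletion_three hv₀
  exact exists_sha_ne_zero_of_congr_of_identityComponent_of_rank_two W W' θ hθ S hS hfin hcop hrank v₀
    (Literature.NumberTheory.EllipticCurves.Rank1Residual.natCast_mem_asIdeal_of_primesEquiv_eq hv₀)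
    (natCard_quot_three_of_primesEquiv_eq hv₀) hδ hnoroot hn3 hoff hcard hcard'
    M C hC x₀ y₀ a hcusp hns₀ hm h3 M' C' hC' x₀' y₀' a' hcusp' hns₀' hm' h3'

/-- **The rank-`1` receiver shape over `ℚ` at `3`** (`…_of_index_le_three` with the side inputs at
`3` discharged). `hidxE : [E(ℚ):3E(ℚ)] ≤ 3` is stated with `ℚ`'s decidable equality and converted
to the classical group law of the tree (`Subsingleton (DecidableEq ℚ)`), as FILE 8d does for `hind`.
[cite: CremonaMazur2000, §3 and Table 1] [cite: AgasheStein2002, Thm. 3.1 and §3.5]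
[cite: MilneADT2006, Ch. I Prop. 3.8 and Lemma 3.3] -/
theorem exists_sha_ne_zero_of_congr_of_identityComponent_of_index_le_three_rat
    (W W' : WeierstrassCurve ℚ) [W.IsElliptic] [W'.IsElliptic]
    (θ : geomTorsion W' ((3 : ℕ) : ℤ) ≃+ geomTorsion W ((3 : ℕ) : ℤ))
    (hθ : ∀ (σ : absoluteGaloisGroup ℚ) (P : geomTorsion W' ((3 : ℕ) : ℤ)), θ (σ • P) = σ • θ P)
    (S : Finset (HeightOneSpectrum (𝓞 ℚ)))
    (hS : ∀ v : HeightOneSpectrum (𝓞 ℚ), v ∉ S →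
      W.HasGoodReductionAt v ∧ W'.HasGoodReductionAt v ∧ ((3 : ℕ) : 𝓞 ℚ) ∉ v.asIdeal)
    (hidxE : (zsmulAddGroupHom ((3 : ℕ) : ℤ) : W.toAffine.Point →+ W.toAffine.Point).range.index ≤ 3)
    (hrank : 3 ≤ W'.mordellWeilRank)
    (v₀ : HeightOneSpectrum (𝓞 ℚ)) (hv₀ : (primesEquiv v₀ : ℕ) = 3)
    (hoff : ∀ v ∈ S, v ≠ v₀ →
      (selmerLocalKer W (v.adicCompletion ℚ) ((3 : ℕ) : ℤ)).relIndex
        ((selmerLocalKer W' (v.adicCompletion ℚ) ((3 : ℕ) : ℤ)).map (h1Equiv θ hθ).toAddMonoidHom) = 1)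
    (hcard : Nat.card (nsmulAddMonoidHom 3 :
      (W.baseChange (v₀.adicCompletion ℚ)).toAffine.Point →+ _).ker = 3)
    (hcard' : Nat.card (nsmulAddMonoidHom 3 :
      (W'.baseChange (v₀.adicCompletion ℚ)).toAffine.Point →+ _).ker = 3)
    (M : WeierstrassCurve (v₀.adicCompletionIntegers ℚ)) (C : VariableChange (v₀.adicCompletion ℚ))
    (hC : C • W.baseChange (v₀.adicCompletion ℚ) =
      M.map (algebraMap (v₀.adicCompletionIntegers ℚ) (v₀.adicCompletion ℚ)))
    (x₀ y₀ a : IsLocalRing.ResidueField (v₀.adicCompletionIntegers ℚ))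
    (hcusp : M.map (IsLocalRing.residue (v₀.adicCompletionIntegers ℚ)) = singularModel x₀ y₀ a a)
    {a₀ b₀ : v₀.adicCompletionIntegers ℚ}
    (hns₀ : (M.map (IsLocalRing.residue (v₀.adicCompletionIntegers ℚ))).toAffine.Nonsingular
      (IsLocalRing.residue (v₀.adicCompletionIntegers ℚ) a₀)
      (IsLocalRing.residue (v₀.adicCompletionIntegers ℚ) b₀))
    (hm : ((M.map (algebraMap (v₀.adicCompletionIntegers ℚ) (v₀.adicCompletion ℚ))).baseChange
        (AlgebraicClosure (v₀.adicCompletion ℚ))).toAffine.Nonsingular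
      (algebraMap (v₀.adicCompletionIntegers ℚ) (AlgebraicClosure (v₀.adicCompletion ℚ)) a₀)
      (algebraMap (v₀.adicCompletionIntegers ℚ) (AlgebraicClosure (v₀.adicCompletion ℚ)) b₀))
    (h3 : (3 : ℤ) • (Affine.Point.some _ _ hm :
      ((M.map (algebraMap (v₀.adicCompletionIntegers ℚ) (v₀.adicCompletion ℚ))).baseChange
        (AlgebraicClosure (v₀.adicCompletion ℚ))).toAffine.Point) = 0)
    (M' : WeierstrassCurve (v₀.adicCompletionIntegers ℚ)) (C' : VariableChange (v₀.adicCompletion ℚ))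
    (hC' : C' • W'.baseChange (v₀.adicCompletion ℚ) =
      M'.map (algebraMap (v₀.adicCompletionIntegers ℚ) (v₀.adicCompletion ℚ)))
    (x₀' y₀' a' : IsLocalRing.ResidueField (v₀.adicCompletionIntegers ℚ))
    (hcusp' : M'.map (IsLocalRing.residue (v₀.adicCompletionIntegers ℚ)) = singularModel x₀' y₀' a' a')
    {a₀' b₀' : v₀.adicCompletionIntegers ℚ}
    (hns₀' : (M'.map (IsLocalRing.residue (v₀.adicCompletionIntegers ℚ))).toAffine.Nonsingular
      (IsLocalRing.residue (v₀.adicCompletionIntegers ℚ) a₀')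
      (IsLocalRing.residue (v₀.adicCompletionIntegers ℚ) b₀'))
    (hm' : ((M'.map (algebraMap (v₀.adicCompletionIntegers ℚ) (v₀.adicCompletion ℚ))).baseChange
        (AlgebraicClosure (v₀.adicCompletion ℚ))).toAffine.Nonsingular
      (algebraMap (v₀.adicCompletionIntegers ℚ) (AlgebraicClosure (v₀.adicCompletion ℚ)) a₀')
      (algebraMap (v₀.adicCompletionIntegers ℚ) (AlgebraicClosure (v₀.adicCompletion ℚ)) b₀'))
    (h3' : (3 : ℤ) • (Affine.Point.some _ _ hm' :
      ((M'.map (algebraMap (v₀.adicCompletionIntegers ℚ) (v₀.adicCompletion ℚ))).baseChange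
        (AlgebraicClosure (v₀.adicCompletion ℚ))).toAffine.Point) = 0) :
    ∃ c : W.sha, c ≠ 0 ∧ 3 • c = 0 := by
  obtain ⟨⟨δ, hδ⟩, hn3, hnoroot⟩ := three_facts_adicCompletion_three hv₀
  exact exists_sha_ne_zero_of_congr_of_identityComponent_of_index_le_three W W' θ hθ S hS
    (by convert hidxE) hrank v₀
    (Literature.NumberTheory.EllipticCurves.Rank1Residual.natCast_mem_asIdeal_of_primesEquiv_eq hv₀)
    (natCard_quot_three_of_primesEquiv_eq hv₀) hδ hnoroot hn3 hoff hcard hcard'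
    M C hC x₀ y₀ a hcusp hns₀ hm h3 M' C' hC' x₀' y₀' a' hcusp' hns₀' hm' h3'

end Summit.BirchSwinnertonDyer.Rank1Residual.GaloisImage.TwistedWitness

end
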